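import Literature.Algebra.Homology.QuasiIsoToHomology
import Literature.Algebra.Homology.MapBifunctorQuasiIso
import Mathlib.Algebra.Homology.Monoidal
import Mathlib.RingTheory.Flat.CategoryTheory
import HarnessLib

/-!
# The Künneth formula for complexes of vector spaces: `Hⁿ(C ⊗ D) ≅ ⨁_{i+j=n} Hⁱ(C) ⊗ Hʲ(D)`

Layer `Literature/Algebra/Homology` (pure homological algebra over Mathlib; 0 definitions, 0 named facts, no instances, no
notation). Weibel, *An introduction to homological algebra*, Thm. 3.6.3 (Künneth formula for complexes) over a FIELD `k`,
where all `Tor₁` terms vanish; Cartan–Eilenberg VI.3.1. For cochain complexes `C`, `D` of `k`-vector spaces, both bounded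
(`C ∈ [a₁, b₁]`, `D ∈ [a₂, b₂]` strictly), and every `n : ℤ`:

  **`nonempty_homology_tensorObj_iso`**:
  `Nonempty (Hⁿ(C ⊗ D) ≅ ((H•(C), 0) ⊗ (H•(D), 0)).Xⁿ)`,

where `C ⊗ D = HomologicalComplex.tensorObj C D` is Mathlib's tensor product of complexes and the right-hand side — the
degree-`n` term of the tensor product of the two homology complexes with ZERO differentials
(`KunnethZeroDifferential.zeroDifferential`) — is BY DEFINITION Mathlib's coproduct `∐_{i+j=n} Hⁱ(C) ⊗ Hʲ(D)`
(`HomologicalComplex.tensorObj = mapBifunctor _ _ (curriedTensor _)`, `GradedObject.mapObj`).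

Proof (three landed rungs): `C ⟶ (H•(C), 0)` and `D ⟶ (H•(D), 0)` are quasi-isomorphisms
(`QuasiIsoToHomology.exists_quasiIso_zeroDifferential_homology`: over a field every subspace is a direct summand); tensoring
with a bounded complex of vector spaces preserves quasi-isomorphisms (`MapBifunctorQuasiIso.quasiIso_mapBifunctorMap_id` /
`_id_right` of the tree, fed by the exactness of `M ⊗ –` and `– ⊗ M` for a (flat) vector space `M`, Mathlib `Module.Flat`);
and the tensor product of two complexes with zero differentials has zero differentials, so is its own homology
(`KunnethZeroDifferential.nonempty_zeroDifferential_mapBifunctor_homologyIso`).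

-- TODO(general form): Weibel 3.6.3 as printed — no boundedness (needs: `– ⊗ D` preserves quasi-isomorphisms for an
-- UNBOUNDED complex `D` of vector spaces, e.g. via K-flatness), over a ring with `Tor₁` correction terms, and the canonical
-- (cross product) map rather than the existence of an isomorphism.

## References

* C. A. Weibel, *An introduction to homological algebra* (1994), Thm. 3.6.3. [Weibel1994]
* H. Cartan, S. Eilenberg, *Homological Algebra* (1956), VI.3, Thm. 3.1. [CartanEilenberg1956]
-/

noncomputable section

-- `GradedObject`/`HomologicalComplex₂.toGradedObject` are not reducible (as in Mathlib's `Algebra/Homology/TotalComplex.lean`).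
set_option backward.isDefEq.respectTransparency false

open CategoryTheory CategoryTheory.Category CategoryTheory.Limits HomologicalComplex
open CategoryTheory.MonoidalCategory (tensorLeft tensorRight curriedTensor)

universe v u

namespace Literature.Algebra.Homology

/-! ### §1 The homology of a bounded complex, as a complex with zero differentials, is bounded -/

section Bounded

variable {V : Type u} [Category.{v} V] [Abelian V] (K : CochainComplex V ℤ)

/-- `(H•(K), 0)` is concentrated in degrees `≥ a` if `K` is. [cite: Weibel1994, Thm. 3.6.3 (proof)] -/
theorem isStrictlyGE_zeroDifferential_homology (a : ℤ) [K.IsStrictlyGE a] :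
    CochainComplex.IsStrictlyGE (zeroDifferential (ComplexShape.up ℤ) (fun i => K.homology i)) a := by
  rw [CochainComplex.isStrictlyGE_iff]
  intro i hi
  exact (ExactAt.of_isZero (K.isZero_of_isStrictlyGE a i hi)).isZero_homology

/-- `(H•(K), 0)` is concentrated in degrees `≤ b` if `K` is. [cite: Weibel1994, Thm. 3.6.3 (proof)] -/
theorem isStrictlyLE_zeroDifferential_homology (b : ℤ) [K.IsStrictlyLE b] :
    CochainComplex.IsStrictlyLE (zeroDifferential (ComplexShape.up ℤ) (fun i => K.homology i)) b := by
  rw [CochainComplex.isStrictlyLE_iff]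
  intro i hi
  exact (ExactAt.of_isZero (K.isZero_of_isStrictlyLE b i hi)).isZero_homology

end Bounded

/-! ### §2 The Künneth formula over a field -/

section Field

variable {k : Type u} [Field k]

/-- **Tensoring with a vector space preserves quasi-isomorphisms** (`M ⊗ –` is exact: a vector space is flat).
[cite: Weibel1994, Thm. 3.6.3 (proof) and Cor. 3.2.10] -/
theorem quasiIso_map_tensorLeft (M : ModuleCat.{u} k) {K K' : CochainComplex (ModuleCat.{u} k) ℤ} (φ : K ⟶ K')
    [QuasiIso φ] : QuasiIso (((tensorLeft M).mapHomologicalComplex (ComplexShape.up ℤ)).map φ) :=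
  inferInstance

/-- **Tensoring with a vector space on the right preserves quasi-isomorphisms** (`– ⊗ M` is exact).
[cite: Weibel1994, Thm. 3.6.3 (proof) and Cor. 3.2.10] -/
theorem quasiIso_map_tensorRight (M : ModuleCat.{u} k) {K K' : CochainComplex (ModuleCat.{u} k) ℤ} (φ : K ⟶ K')
    [QuasiIso φ] : QuasiIso (((tensorRight M).mapHomologicalComplex (ComplexShape.up ℤ)).map φ) := by
  haveI : PreservesFiniteColimits (tensorRight M) :=
    preservesFiniteColimits_of_natIso (BraidedCategory.tensorLeftIsoTensorRight M)
  infer_instance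

/-- **The Künneth formula for bounded complexes of vector spaces**: `Hⁿ(C ⊗ D) ≅ ((H•(C), 0) ⊗ (H•(D), 0))ⁿ`, the latter
being Mathlib's coproduct `∐_{i+j=n} Hⁱ(C) ⊗ Hʲ(D)`. [cite: Weibel1994, Thm. 3.6.3] [cite: CartanEilenberg1956, VI.3 Thm. 3.1] -/
theorem nonempty_homology_tensorObj_iso (C D : CochainComplex (ModuleCat.{u} k) ℤ) (a₁ b₁ a₂ b₂ : ℤ)
    [C.IsStrictlyGE a₁] [C.IsStrictlyLE b₁] [D.IsStrictlyGE a₂] [D.IsStrictlyLE b₂] (n : ℤ) :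
    Nonempty ((HomologicalComplex.tensorObj C D).homology n ≅
      (HomologicalComplex.tensorObj (zeroDifferential (ComplexShape.up ℤ) (fun i => C.homology i))
        (zeroDifferential (ComplexShape.up ℤ) (fun j => D.homology j))).X n) := by
  obtain ⟨ρC, hρC⟩ := exists_quasiIso_zeroDifferential_homology C
  obtain ⟨ρD, hρD⟩ := exists_quasiIso_zeroDifferential_homology D
  haveI := isStrictlyGE_zeroDifferential_homology D a₂
  haveI := isStrictlyLE_zeroDifferential_homology D b₂
  -- `C ⊗ D ⟶ C ⊗ (H(D), 0)` is a quasi-isomorphism (`C` bounded, `Cᵖ ⊗ –` exact)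
  haveI h₁ : QuasiIso (mapBifunctorMap (𝟙 C) ρD (curriedTensor (ModuleCat.{u} k)) (ComplexShape.up ℤ)) :=
    quasiIso_mapBifunctorMap_id (curriedTensor (ModuleCat.{u} k)) ρD C a₁ b₁ fun p => quasiIso_map_tensorLeft (C.X p) ρD
  -- `C ⊗ (H(D), 0) ⟶ (H(C), 0) ⊗ (H(D), 0)` is a quasi-isomorphism (`(H(D), 0)` bounded, `– ⊗ Hᵖ(D)` exact)
  haveI h₂ : QuasiIso (mapBifunctorMap ρC (𝟙 (zeroDifferential (ComplexShape.up ℤ) (fun j => D.homology j)))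
      (curriedTensor (ModuleCat.{u} k)) (ComplexShape.up ℤ)) :=
    quasiIso_mapBifunctorMap_id_right (curriedTensor (ModuleCat.{u} k)) ρC _ a₂ b₂ fun p =>
      quasiIso_map_tensorRight _ ρC
  obtain ⟨e⟩ := nonempty_zeroDifferential_mapBifunctor_homologyIso (c₁ := ComplexShape.up ℤ) (c₂ := ComplexShape.up ℤ)
    (curriedTensor (ModuleCat.{u} k)) (ComplexShape.up ℤ) (fun i => C.homology i) (fun j => D.homology j) n
  exact ⟨isoOfQuasiIsoAt (mapBifunctorMap (𝟙 C) ρD (curriedTensor (ModuleCat.{u} k)) (ComplexShape.up ℤ) ≫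
      mapBifunctorMap ρC (𝟙 (zeroDifferential (ComplexShape.up ℤ) (fun j => D.homology j)))
        (curriedTensor (ModuleCat.{u} k)) (ComplexShape.up ℤ)) n ≪≫ e⟩

end Field

end Literature.Algebra.Homology

end
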